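import Summits.QuantumFields.BalabanUV.Beta.GAN24.EnvelopeBlockSum

/-!
# `BalabanUV.Beta.GAN24.SlotChargeMoment` — binder row G-an2-4 ∕ (CONV-C), W-slot, the (α-0) parity re-cut, located crux (Q-L-k₀) (COUNT C-leaf01-g74-1
# (iv), journal l.53136): **THE SLOT CHARGES OF A TABLE ARE THE FIRST MOMENTS OF ITS SLOT DIVERGENCES** — summation by parts, and the resulting
# `LocStencil`-shaped bounds on the charges from `LocStencil`-shaped bounds on the divergences (the `g`-rows of `GAN24/ThreeLegDoubleFreeze`).

NOT IN PRINT; OUR BOOKKEEPING ([folklore] real analysis; 0 `def`, 0 cited facts, 0 `def … : Prop`, 0 sorry, 0 wall binders).  HONEST FRAMING (cell contract,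
verbatim): «discharging `BetaPertH` makes Bałaban's UV stability UNCONDITIONAL — a real constructive-QFT result; it is NOT the continuum limit and NOT
the Clay problem.»  HONEST DEPENDENCY (verbatim): «continuum YM on T⁴ ⇐ BetaPertH ∧ nine spine estimates (0/9 proved); BetaPertH ⇐ (D1) ∧ (D4) ∧
CAP+tail; G-an2-4 gates asym, D1 and NE2/3/4.»

## What is proved (generic `d`)
* §1 **`tsum_moment_div_eq`** — for a decaying `1`-form `f μ y` on `ℤ^{d+1}` and any anchor `x₀`:
  `Σ'_y (y − x₀)_λ · Σ_μ (f μ (y − e_μ) − f μ y) = Σ'_y f λ y` — the `λ`-CHARGE of `f` is the `λ`-th first moment of its backward divergence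
  (`KernelWard.divW`'s shape); in particular a divergence-free decaying `1`-form is charge-free in every direction.
* §2 **`abs_tsum_le_of_div_bound`** — if `|Σ_μ (f μ (y − e_μ) − f μ y)| ≤ g₀·e^{−δ|y − c|₁}` and `|f μ y| ≤ B·e^{−δ|y − c|₁}`, then
  `|Σ'_y f λ y| ≤ g₀·(2/δ)·Zl(δ/2)` (`LatticeFreeze.mul_exp_neg_le`).
* §3 the TABLE forms consumed by `GAN24/ThreeLegDoubleFreeze.abs_threeLeg_blockSum_le`: **`abs_slotCharge_fst_le`** — for a `LocStencil₂` table `T` whose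
  first-slot divergence `divW T y κ′ v′` is bounded by `g₀·e^{−δ|v′−y|₁}·e^{−δ(|x−y|₁+|z−y|₁)}` entrywise, the first-slot charge obeys
  `|Σ'_v T κ v κ′ v′ x z a b| ≤ (g₀·(2/(δ/3))·Zl(δ/6))·e^{−(δ/3)(|x−v′|₁+|z−v′|₁)}`; **`abs_slotCharge_snd_le`** — the second-slot twin (divergence in the second
  bond, bound centred at the first slot): `|Σ'_{v′} T κ v κ′ v′ x z a b| ≤ (g₀·(2/δ)·Zl(δ/2))·e^{−δ(|x−v|₁+|z−v|₁)}`.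
Asserts NOTHING about Bałaban's tables; (H3)'s slaving of the divergences is leaf-03's row; discharges NOTHING of (Q-L) ∕ (H1♮) ∕ (C) ∕ «T2Shape» ∕
«T2Drift» ∕ (hW, hWall); NEVER «G-an2-4 closed» as (CONV-C); NOT D1, NOT `BetaPertH`, NOT continuum, NOT Clay; not in print.
Unit `b2b-balaban-gan24-formalise-leaf-01` (G-an2-4 formalisation swarm, leaf prover 01, gen 74), 2026-08-23.
-/

noncomputable section

open Finset
open scoped BigOperators
open Literature.MathematicalPhysics.QuantumFieldTheory.Balaban1983to89
open Literature.MathematicalPhysics.QuantumFieldTheory.Balaban1983to89.Beta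
open B6BondElimination (unitVec unitVec_apply)
open B12Sec2to5 (l1 l1_nonneg)
open ExpKernelCalculus (MKer Zl Zl_nonneg Zl_pos summable_exp_shift' tsum_exp_shift' l1_sub_triangle l1_sub_symm)
open OneStepResolventKernel (Fib)
open BalabanCompositeJets (LocStencil₂ LocStencil₂.nonneg)
open KernelWard (divW)
open Summit.QuantumFields.BalabanUV.Beta.GAN24.LatticeFreeze (mul_exp_neg_le)
open Summit.QuantumFields.BalabanUV.Beta.GAN24.BiStencilZeroMode (Tab)

namespace Summit.QuantumFields.BalabanUV.Beta.GAN24.SlotChargeMoment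

variable {d : ℕ}

/-! ## §1 Summation by parts: the charge is the first moment of the divergence -/

/-- [folklore] **SUMMATION BY PARTS**: for a `1`-form `f` with summable first moments about `x₀`,
`Σ'_y (y − x₀)_λ · Σ_μ (f μ (y − e_μ) − f μ y) = Σ'_y f λ y`. -/
theorem tsum_moment_div_eq {f : Fin (d + 1) → (Fin (d + 1) → ℤ) → ℝ} (x₀ : Fin (d + 1) → ℤ) (lam : Fin (d + 1))
    (hf : ∀ μ, Summable fun y => f μ y) (hfm : ∀ μ, Summable fun y => (((y - x₀) lam : ℤ) : ℝ) * f μ y) :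
    ∑' y, (((y - x₀) lam : ℤ) : ℝ) * ∑ μ, (f μ (y - unitVec μ) - f μ y) = ∑' y, f lam y := by
  -- shifted moments are summable too
  have hfm' : ∀ μ, Summable fun y => (((y - x₀) lam : ℤ) : ℝ) * f μ (y - unitVec μ) := by
    intro μ
    have e : (fun y => (((y - x₀) lam : ℤ) : ℝ) * f μ (y - unitVec μ))
        = fun y => ((((y - unitVec μ) - x₀) lam : ℤ) : ℝ) * f μ (y - unitVec μ) + ((unitVec μ lam : ℤ) : ℝ) * f μ (y - unitVec μ) := by
      funext y
      have : (((y - x₀) lam : ℤ) : ℝ) = ((((y - unitVec μ) - x₀) lam : ℤ) : ℝ) + ((unitVec μ lam : ℤ) : ℝ) := by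
        push_cast [Pi.sub_apply]; ring
      rw [this]; ring
    rw [e]
    refine Summable.add ?_ (((hf μ).comp_injective (sub_left_injective (b := unitVec μ))).mul_left _)
    exact (hfm μ).comp_injective (sub_left_injective (b := unitVec μ))
  -- split the finite `μ`-sum and the differences
  have e1 : ∀ y, (((y - x₀) lam : ℤ) : ℝ) * ∑ μ, (f μ (y - unitVec μ) - f μ y)
      = ∑ μ, ((((y - x₀) lam : ℤ) : ℝ) * f μ (y - unitVec μ) - (((y - x₀) lam : ℤ) : ℝ) * f μ y) := fun y => by
    rw [Finset.mul_sum]; exact Finset.sum_congr rfl fun μ _ => by ring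
  simp_rw [e1]
  rw [Summable.tsum_finsetSum (fun μ _ => (hfm' μ).sub (hfm μ))]
  have e2 : ∀ μ, ∑' y, ((((y - x₀) lam : ℤ) : ℝ) * f μ (y - unitVec μ) - (((y - x₀) lam : ℤ) : ℝ) * f μ y)
      = ((unitVec μ lam : ℤ) : ℝ) * ∑' y, f μ y := by
    intro μ
    rw [(hfm' μ).tsum_sub (hfm μ)]
    -- shift the first series by `e_μ`
    have hshift : ∑' y, (((y - x₀) lam : ℤ) : ℝ) * f μ (y - unitVec μ) = ∑' y, ((((y + unitVec μ) - x₀) lam : ℤ) : ℝ) * f μ y := by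
      rw [← (Equiv.subRight (unitVec μ)).tsum_eq (fun y => ((((y + unitVec μ) - x₀) lam : ℤ) : ℝ) * f μ y)]
      refine tsum_congr fun y => ?_
      simp only [Equiv.subRight_apply, sub_add_cancel]
    rw [hshift]
    have e3 : ∀ y, ((((y + unitVec μ) - x₀) lam : ℤ) : ℝ) * f μ y = (((y - x₀) lam : ℤ) : ℝ) * f μ y + ((unitVec μ lam : ℤ) : ℝ) * f μ y := by
      intro y; push_cast [Pi.sub_apply, Pi.add_apply]; ring
    simp_rw [e3]
    rw [(hfm μ).tsum_add ((hf μ).mul_left _), tsum_mul_left]; ring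
  simp_rw [e2]
  -- `Σ_μ (e_μ)_λ · Σ' f μ = Σ' f λ`
  simp only [unitVec_apply]
  rw [Finset.sum_eq_single lam (fun μ _ hμ => by rw [if_neg (Ne.symm hμ)]; simp) (fun h => (h (Finset.mem_univ _)).elim)]
  simp

/-! ## §2 The charge bound from a divergence bound -/

/-- [folklore] **CHARGE ≤ FIRST MOMENT OF THE DIVERGENCE**: if the `1`-form decays about `c` (for summability) and its backward divergence is bounded by
`g₀·e^{−δ′|y − c|₁}`, then every charge obeys `|Σ'_y f λ y| ≤ g₀·(2/δ′)·Zl(δ′/2)`. -/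
theorem abs_tsum_le_of_div_bound {f : Fin (d + 1) → (Fin (d + 1) → ℤ) → ℝ} {c : Fin (d + 1) → ℤ} {B g₀ δ δ' : ℝ} (hδ : 0 < δ) (hδ' : 0 < δ')
    (hf : ∀ μ y, |f μ y| ≤ B * Real.exp (-δ * l1 (y - c)))
    (hdiv : ∀ y, |∑ μ, (f μ (y - unitVec μ) - f μ y)| ≤ g₀ * Real.exp (-δ' * l1 (y - c))) (lam : Fin (d + 1)) :
    |∑' y, f lam y| ≤ g₀ * (2 / δ' * Zl (d + 1) (δ' / 2)) := by
  -- `|(y − c)_λ| ≤ |y − c|₁` (leaf-04's `LayerPushGaugeTable.abs_cast_apply_le_l1`, inlined to keep the import light)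
  have abs_coord_le_l1 : ∀ (v : Fin (d + 1) → ℤ) (i : Fin (d + 1)), |((v i : ℤ) : ℝ)| ≤ l1 v := fun v i => by
    unfold l1
    exact Finset.single_le_sum (f := fun μ => |((v μ : ℤ) : ℝ)|) (fun μ _ => abs_nonneg _) (Finset.mem_univ i)
  have hB : 0 ≤ B := by
    have h0 := hf lam c
    rw [sub_self, show l1 (0 : Fin (d + 1) → ℤ) = 0 by simp [l1], mul_zero, Real.exp_zero, mul_one] at h0
    exact (abs_nonneg _).trans h0
  have hg₀ : 0 ≤ g₀ := by
    have h0 := hdiv c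
    rw [sub_self, show l1 (0 : Fin (d + 1) → ℤ) = 0 by simp [l1], mul_zero, Real.exp_zero, mul_one] at h0
    exact (abs_nonneg _).trans h0
  -- summabilities
  have hfs : ∀ μ, Summable fun y => f μ y := fun μ =>
    Summable.of_norm_bounded ((summable_exp_shift' hδ c).mul_left B) fun y => by rw [Real.norm_eq_abs]; exact hf μ y
  have hfm : ∀ μ, Summable fun y => (((y - c) lam : ℤ) : ℝ) * f μ y := by
    intro μ
    refine Summable.of_norm_bounded ((summable_exp_shift' (half_pos hδ) c).mul_left (B * (2 / δ))) fun y => ?_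
    rw [Real.norm_eq_abs, abs_mul]
    have hm := mul_exp_neg_le hδ (l1 (y - c))
    calc |(((y - c) lam : ℤ) : ℝ)| * |f μ y| ≤ l1 (y - c) * (B * Real.exp (-δ * l1 (y - c))) :=
          mul_le_mul (abs_coord_le_l1 _ _) (hf μ y) (abs_nonneg _) (l1_nonneg _)
      _ = B * (l1 (y - c) * Real.exp (-δ * l1 (y - c))) := by ring
      _ ≤ B * (2 / δ * Real.exp (-(δ / 2) * l1 (y - c))) := mul_le_mul_of_nonneg_left hm hB
      _ = _ := by ring
  rw [← tsum_moment_div_eq c lam hfs hfm]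
  -- the first moment of the divergence
  have hs := (summable_exp_shift' (half_pos hδ') c).mul_left (g₀ * (2 / δ'))
  have hb := tsum_of_norm_bounded hs.hasSum (f := fun y => (((y - c) lam : ℤ) : ℝ) * ∑ μ, (f μ (y - unitVec μ) - f μ y)) fun y => by
    rw [Real.norm_eq_abs, abs_mul]
    have hm := mul_exp_neg_le hδ' (l1 (y - c))
    calc |(((y - c) lam : ℤ) : ℝ)| * |∑ μ, (f μ (y - unitVec μ) - f μ y)| ≤ l1 (y - c) * (g₀ * Real.exp (-δ' * l1 (y - c))) :=
          mul_le_mul (abs_coord_le_l1 _ _) (hdiv y) (abs_nonneg _) (l1_nonneg _)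
      _ = g₀ * (l1 (y - c) * Real.exp (-δ' * l1 (y - c))) := by ring
      _ ≤ g₀ * (2 / δ' * Real.exp (-(δ' / 2) * l1 (y - c))) := mul_le_mul_of_nonneg_left hm hg₀
      _ = _ := by ring
  rw [Real.norm_eq_abs, tsum_mul_left, tsum_exp_shift'] at hb
  refine hb.trans (le_of_eq ?_); ring

/-! ## §3 The table forms (the `g`-rows of `GAN24/ThreeLegDoubleFreeze`) -/

/-- [folklore] `divW` read entrywise. -/
theorem divW_apply_entry (T : Tab d) (y : Fin (d + 1) → ℤ) (ν : Fin (d + 1)) (y' : Fin (d + 1) → ℤ) (x z : Fin (d + 1) → ℤ) (a b : Fib d) :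
    divW T y ν y' x z a b = ∑ μ, (T μ (y - unitVec μ) ν y' x z a b - T μ y ν y' x z a b) := by
  simp only [divW, Finset.sum_apply, Pi.sub_apply]

/-- [folklore] Re-centring at rate `δ/3`: `e^{−δ|v′−y|₁}·e^{−δ(|x−y|₁+|z−y|₁)} ≤ e^{−(δ/3)(|x−v′|₁+|z−v′|₁)}·e^{−(δ/3)|y−v′|₁}`. -/
theorem recenter_snd {δ : ℝ} (hδ : 0 ≤ δ) (y v' x z : Fin (d + 1) → ℤ) :
    Real.exp (-δ * l1 (v' - y)) * Real.exp (-δ * (l1 (x - y) + l1 (z - y)))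
      ≤ Real.exp (-(δ / 3) * (l1 (x - v') + l1 (z - v'))) * Real.exp (-(δ / 3) * l1 (y - v')) := by
  rw [← Real.exp_add, ← Real.exp_add, Real.exp_le_exp]
  have h1 := l1_sub_triangle x y v'
  have h2 := l1_sub_triangle z y v'
  have h3 := l1_sub_symm v' y
  have h4 := l1_nonneg (v' - y); have h5 := l1_nonneg (x - y); have h6 := l1_nonneg (z - y)
  nlinarith

/-- NOT IN PRINT; OUR BOOKKEEPING.  **THE FIRST-SLOT CHARGE FROM THE FIRST-SLOT DIVERGENCE** (`KernelWard.divW`): for a `LocStencil₂` table `T` whose first-slot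
divergence table obeys `|divW T y κ′ v′ x z a b| ≤ g₀·e^{−δ|v′−y|₁}·e^{−δ(|x−y|₁+|z−y|₁)}`, every first-slot charge obeys
`|Σ'_v T κ v κ′ v′ x z a b| ≤ (g₀·(2/(δ/3))·Zl(δ/6))·e^{−(δ/3)(|x−v′|₁+|z−v′|₁)}` — the `hq₁`-row of `ThreeLegDoubleFreeze.abs_threeLeg_blockSum_le` at rate `δ/3`. -/
theorem abs_slotCharge_fst_le {T : Tab d} {C g₀ δ : ℝ} (hδ : 0 < δ) (hT : LocStencil₂ T C δ)
    (hD : ∀ y κ' v' x z a b, |divW T y κ' v' x z a b| ≤ g₀ * Real.exp (-δ * l1 (v' - y)) * Real.exp (-δ * (l1 (x - y) + l1 (z - y))))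
    (κ κ' : Fin (d + 1)) (v' x z : Fin (d + 1) → ℤ) (a b : Fib d) :
    |∑' v, T κ v κ' v' x z a b| ≤ (g₀ * (2 / (δ / 3) * Zl (d + 1) (δ / 3 / 2))) * Real.exp (-(δ / 3) * (l1 (x - v') + l1 (z - v'))) := by
  have hC : 0 ≤ C := hT.nonneg
  have hg₀ : 0 ≤ g₀ := by
    have h0 := hD v' κ' v' v' v' a b
    rw [sub_self, show l1 (0 : Fin (d + 1) → ℤ) = 0 by simp [l1], mul_zero, add_zero, mul_zero, Real.exp_zero, mul_one, mul_one] at h0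
    exact (abs_nonneg _).trans h0
  -- the `1`-form `f μ y := T μ y κ′ v′ x z a b`, centred at `v′`
  have hf : ∀ μ y, |T μ y κ' v' x z a b| ≤ C * Real.exp (-δ * l1 (y - v')) := by
    intro μ y
    refine (hT μ y κ' v' x z a b).trans ?_
    have h1 : Real.exp (-δ * (l1 (x - y) + l1 (z - y))) ≤ 1 := by
      rw [Real.exp_le_one_iff]; have := l1_nonneg (x - y); have := l1_nonneg (z - y); nlinarith
    rw [l1_sub_symm v' y]
    calc C * Real.exp (-δ * l1 (y - v')) * Real.exp (-δ * (l1 (x - y) + l1 (z - y))) ≤ C * Real.exp (-δ * l1 (y - v')) * 1 := by gcongr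
      _ = _ := mul_one _
  have hdiv : ∀ y, |∑ μ, (T μ (y - unitVec μ) κ' v' x z a b - T μ y κ' v' x z a b)|
      ≤ (g₀ * Real.exp (-(δ / 3) * (l1 (x - v') + l1 (z - v')))) * Real.exp (-(δ / 3) * l1 (y - v')) := by
    intro y
    rw [← divW_apply_entry]
    refine (hD y κ' v' x z a b).trans ?_
    rw [mul_assoc, mul_assoc]
    exact mul_le_mul_of_nonneg_left (recenter_snd hδ.le y v' x z) hg₀
  have h := abs_tsum_le_of_div_bound (f := fun μ y => T μ y κ' v' x z a b) hδ (by positivity : 0 < δ / 3) hf hdiv κ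
  refine h.trans (le_of_eq ?_); ring

/-- NOT IN PRINT; OUR BOOKKEEPING.  **THE SECOND-SLOT CHARGE FROM THE SECOND-SLOT DIVERGENCE**: if the second-bond backward divergence of a `LocStencil₂` table
obeys `|Σ_μ (T κ v μ (y − e_μ) − T κ v μ y) x z a b| ≤ g₀·e^{−δ|y−v|₁}·e^{−δ(|x−v|₁+|z−v|₁)}` (centred at the first slot), then
`|Σ'_{v′} T κ v κ′ v′ x z a b| ≤ (g₀·(2/δ)·Zl(δ/2))·e^{−δ(|x−v|₁+|z−v|₁)}` — the `hq₂`-row of `ThreeLegDoubleFreeze.abs_threeLeg_blockSum_le`, at the table's rate. -/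
theorem abs_slotCharge_snd_le {T : Tab d} {C g₀ δ : ℝ} (hδ : 0 < δ) (hT : LocStencil₂ T C δ)
    (hD : ∀ κ v y x z a b, |∑ μ, (T κ v μ (y - unitVec μ) x z a b - T κ v μ y x z a b)|
      ≤ g₀ * Real.exp (-δ * l1 (y - v)) * Real.exp (-δ * (l1 (x - v) + l1 (z - v))))
    (κ κ' : Fin (d + 1)) (v x z : Fin (d + 1) → ℤ) (a b : Fib d) :
    |∑' v', T κ v κ' v' x z a b| ≤ (g₀ * (2 / δ * Zl (d + 1) (δ / 2))) * Real.exp (-δ * (l1 (x - v) + l1 (z - v))) := by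
  have hC : 0 ≤ C := hT.nonneg
  have hg₀ : 0 ≤ g₀ := by
    have h0 := hD κ v v v v a b
    rw [sub_self, show l1 (0 : Fin (d + 1) → ℤ) = 0 by simp [l1], mul_zero, add_zero, mul_zero, Real.exp_zero, mul_one, mul_one] at h0
    exact (abs_nonneg _).trans h0
  have hf : ∀ μ y, |T κ v μ y x z a b| ≤ C * Real.exp (-δ * l1 (y - v)) := by
    intro μ y
    refine (hT κ v μ y x z a b).trans ?_
    have h1 : Real.exp (-δ * (l1 (x - v) + l1 (z - v))) ≤ 1 := by
      rw [Real.exp_le_one_iff]; have := l1_nonneg (x - v); have := l1_nonneg (z - v); nlinarith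
    calc C * Real.exp (-δ * l1 (y - v)) * Real.exp (-δ * (l1 (x - v) + l1 (z - v))) ≤ C * Real.exp (-δ * l1 (y - v)) * 1 := by gcongr
      _ = _ := mul_one _
  have hdiv : ∀ y, |∑ μ, (T κ v μ (y - unitVec μ) x z a b - T κ v μ y x z a b)|
      ≤ (g₀ * Real.exp (-δ * (l1 (x - v) + l1 (z - v)))) * Real.exp (-δ * l1 (y - v)) := fun y =>
    (hD κ v y x z a b).trans (le_of_eq (by ring))
  have h := abs_tsum_le_of_div_bound (f := fun μ y => T κ v μ y x z a b) hδ hδ hf hdiv κ'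
  refine h.trans (le_of_eq ?_); ring

end Summit.QuantumFields.BalabanUV.Beta.GAN24.SlotChargeMoment

end
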